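import Summits.CriticalPhenomena.CardyFormulaZ2.Theses.CardyNeumannHarmonic

/-!
# `InteriorHarmonicity` — birth skeleton (BC3), crux `stmt-CriticalPhenomena-18933`
of `route-CriticalPhenomena-CardyNeumannHarmonic` (sub-problem `CardyFormulaZ2`).

Crux (fixed, the route's decl, not restated): for every rectilinear 3-marked Jordan domain `T`,
every mesh sequence `u n → 0⁺` and every continuous locally uniform limit `G = (G 0, G 1, G 2)` of
the bond-`ℤ²` separating probabilities `H^{u n}_α = bondSeparatingProb T α (u n)` on `T.carrier`,
each `G α` is weakly harmonic: `∫ G α · Δφ = 0` for every nonnegative `C²` test function `φ`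
compactly supported in the carrier.

Line `birth` ("symmetric / antisymmetric decoupling" — the route header's alternative split,
TWO-LAYER PLAN: "Σ_β G_β harmonic (weak BondSumRule) + pairwise differences harmonic"):
the triple `G` is recovered from its SYMMETRIC part `S = G 0 + G 1 + G 2` and its ANTISYMMETRIC
parts `W_α = G (α+1) − G (α+2)` by the exact identity `3 · G α = S + (G α − G (α+1)) + (G α − G (α+2))`
`= S − W_(α+2) + W_(α+1)`, and weak harmonicity is linear. The two parts have DIFFERENT lattice
mechanisms and different literature:

* `stub_sum : Sig.stub_sum` — the sum `S` of a sublimit triple is weakly harmonic. This is the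
  sublimit shadow of the sum rule `Σ_α H^δ_α → 1` (crux `BondSumRule`, stmt-CriticalPhenomena-8934 of
  route CardyDiscreteHolo, which implies it: `S ≡ 1` and `∫ Δφ = 0`); on site-`𝕋` it is Smirnov's
  `h_0 + h_1 + h_2 ≡ 1` (Bollobás–Riordan Ch. 7 Claim 24). Mechanism proposed in the pool: the
  expected number of corners whose outermost open crossing passes beyond `z` tends to `1`
  (self-duality of bond-`ℤ²` at `p = 1/2` trades open for dual separation); independently it follows
  from the sibling crux `MoreraOnZ2` (stmt-CriticalPhenomena-0798, route CardyHarmonicInvariants): the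
  contour relation `S_(i+1) = τ S_i` for sublimits gives `Σ_i S_i = 0`, so the real continuous `S` has
  vanishing contour integrals and is locally constant (constant not identified). Size: open (L/XL),
  but strictly weaker than `BondSumRule`, than `MoreraOnZ2` and than the crux.
* `stub_diff : Sig.stub_diff` — each difference `W_α = G (α+1) − G (α+2)` of a sublimit triple is
  weakly harmonic in the interior. These are exactly the objects of the route's other crux
  `EvenReflectionLaw` (Neumann law for `W_α` at flat boundary pieces) and of its two-layer node
  `LayerHarmonicity`; on site-`𝕋` the span of the `W_α` is the span of `Re F, Im F` for Smirnov's
  `F = Σ_α τ^α G_α`, so the stub follows from MORERA for `F` alone (sibling crux `MoreraOnZ2` of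
  route CardyHarmonicInvariants), without any sum rule. Mechanism: the lattice reflection exchanging
  the `(α+1)`- and `(α+2)`-hull pictures makes the signed three-arm expansion of `Δ_δ W_α`
  antisymmetric; the load-bearing stub. Size: open (XL).
* `InteriorHarmonicity_of` — the kernel-checked composition: integrability of `G β · Δφ`
  (continuous on the compact `tsupport φ ⊆ T.carrier`, zero off it), additivity of the Bochner
  integral, and the linear algebra `I 1 = I 2, I 2 = I 0, I 0 + I 1 + I 2 = 0 ⇒ I α = 0`.

This replaces the planner's birth-time `≤ / ≥` (weakly sub/super-harmonic) split, which the
birth refuter (refuter-rattack-stmt-CriticalPhenomena-18933-0, ATTACK.md) judged tautological: here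
neither stub has the other as its mirror image, each is STRICTLY WEAKER than the crux (the crux
gives both by linearity; neither gives the crux: `S` fixes `G` only up to the antisymmetric part and
the `W_α` only up to a common summand), and each is the input of a different existing programme
(`BondSumRule` resp. `MoreraOnZ2` / `EvenReflectionLaw`).

Disproof used: none on file (`ledger crux ls stmt-CriticalPhenomena-18933`: no `Disproof.lean`, no
`Negative/` lemma; `ledger negatives --problem CriticalPhenomena`: 11 entries, none about
`bondSeparatingProb`). No `_false_without_` obstruction exists to honour.
-/

namespace Summit.CriticalPhenomena.CardyFormulaZ2.Cruxes.InteriorHarmonicity.Birth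

open Filter Set MeasureTheory Topology
open Literature.Probability.Percolation Literature.Probability.RandomPlanarGeometry
open Summit.CriticalPhenomena.CardyFormulaZ2.Theses.CardyNeumannHarmonic

/-! ### Stub signatures (named `Prop`s, so that `InteriorHarmonicity_of` takes its hypotheses BY NAME) -/

/-- Signature of `stub_sum` — **the symmetric part of every sublimit triple is weakly harmonic**:
same data and hypotheses as the crux (rectilinear `T`, mesh sequence `u`, continuous locally uniform
limit `G` of the three separating probabilities), conclusion
`∫ (G 0 + G 1 + G 2) · Δφ = 0` for every nonnegative `C²` test `φ` compactly supported in the carrier. -/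
def Sig.stub_sum : Prop :=
  ∀ (T : Literature.Probability.RandomPlanarGeometry.MarkedDomain 3),
    (∃ S : Finset (ℂ × ℂ), (∀ p ∈ S, p.1.re = p.2.re ∨ p.1.im = p.2.im) ∧
      frontier T.carrier ⊆ ⋃ p ∈ S, segment ℝ p.1 p.2) →
    ∀ (u : ℕ → ℝ) (G : Fin 3 → ℂ → ℝ), (∀ n, 0 < u n) → Filter.Tendsto u Filter.atTop (nhds 0) →
    (∀ α : Fin 3, TendstoLocallyUniformlyOn
      (fun (n : ℕ) (z : ℂ) => Literature.Probability.Percolation.bondSeparatingProb T α (u n) z)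
      (G α) Filter.atTop T.carrier) →
    (∀ α : Fin 3, ContinuousOn (G α) T.carrier) →
    ∀ (φ : ℂ → ℝ), ContDiff ℝ 2 φ → HasCompactSupport φ → tsupport φ ⊆ T.carrier →
    (∀ z : ℂ, 0 ≤ φ z) →
    ∫ z, (G 0 z + G 1 z + G 2 z) * (Laplacian.laplacian φ : ℂ → ℝ) z = 0

/-- Signature of `stub_diff` — **the antisymmetric parts of every sublimit triple are weakly
harmonic in the interior**: same data and hypotheses as the crux, conclusion
`∫ (G (α+1) − G (α+2)) · Δφ = 0` for every corner index `α` and every nonnegative `C²` test `φ`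
compactly supported in the carrier (`W_α = G (α+1) − G (α+2)` is the object of the route's crux
`EvenReflectionLaw`). -/
def Sig.stub_diff : Prop :=
  ∀ (T : Literature.Probability.RandomPlanarGeometry.MarkedDomain 3),
    (∃ S : Finset (ℂ × ℂ), (∀ p ∈ S, p.1.re = p.2.re ∨ p.1.im = p.2.im) ∧
      frontier T.carrier ⊆ ⋃ p ∈ S, segment ℝ p.1 p.2) →
    ∀ (u : ℕ → ℝ) (G : Fin 3 → ℂ → ℝ), (∀ n, 0 < u n) → Filter.Tendsto u Filter.atTop (nhds 0) →
    (∀ α : Fin 3, TendstoLocallyUniformlyOn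
      (fun (n : ℕ) (z : ℂ) => Literature.Probability.Percolation.bondSeparatingProb T α (u n) z)
      (G α) Filter.atTop T.carrier) →
    (∀ α : Fin 3, ContinuousOn (G α) T.carrier) →
    ∀ (α : Fin 3) (φ : ℂ → ℝ), ContDiff ℝ 2 φ → HasCompactSupport φ → tsupport φ ⊆ T.carrier →
    (∀ z : ℂ, 0 ≤ φ z) →
    ∫ z, (G (α + 1) z - G (α + 2) z) * (Laplacian.laplacian φ : ℂ → ℝ) z = 0

/-! ### The stubs -/

/-- **Stub 1 (symmetric part; sublimit shadow of the sum rule `BondSumRule`, stmt-CriticalPhenomena-8934).** -/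
theorem stub_sum : Sig.stub_sum := by
  sorry

/-- **Stub 2 (antisymmetric parts; interior harmonicity of the `EvenReflectionLaw` objects
`W_α = G (α+1) − G (α+2)`; the load-bearing stub).** -/
theorem stub_diff : Sig.stub_diff := by
  sorry

/-! ### Analysis used by the composition (complete proofs) -/

/-- The Laplacian of a `C²` function on `ℂ` is continuous. -/
theorem continuous_laplacian_of_contDiff {φ : ℂ → ℝ} (hφ : ContDiff ℝ 2 φ) :
    Continuous (Laplacian.laplacian φ : ℂ → ℝ) := by
  rw [InnerProductSpace.laplacian_eq_iteratedFDeriv_complexPlane]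
  have h2 : Continuous fun x => iteratedFDeriv ℝ 2 φ x := hφ.continuous_iteratedFDeriv le_rfl
  exact (h2.eval_const _).add (h2.eval_const _)

/-- The Laplacian of `φ` vanishes off the topological support of `φ`. -/
theorem support_laplacian_subset_tsupport (φ : ℂ → ℝ) :
    Function.support (Laplacian.laplacian φ : ℂ → ℝ) ⊆ tsupport φ := by
  intro x hx
  by_contra hx'
  apply hx
  have h0 : φ =ᶠ[𝓝 x] (fun _ => (0 : ℝ)) := notMem_tsupport_iff_eventuallyEq.mp hx'
  have h1 := (InnerProductSpace.laplacian_congr_nhds h0).self_of_nhds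
  rw [h1, InnerProductSpace.laplacian_const]
  rfl

/-- Integrability of `G · Δφ` for `G` continuous on an open set containing the (compact) support of
the `C²` test function `φ`: the integrand is continuous on the compact `tsupport φ` and vanishes
off it, so no Bochner junk value can occur in the stubs or in the crux. -/
theorem integrable_mul_laplacian {Ω : Set ℂ} {G φ : ℂ → ℝ} (hG : ContinuousOn G Ω)
    (hφ : ContDiff ℝ 2 φ) (hsupp : HasCompactSupport φ) (htsupp : tsupport φ ⊆ Ω) :
    Integrable (fun z => G z * (Laplacian.laplacian φ : ℂ → ℝ) z) := by
  have hK : IsCompact (tsupport φ) := hsupp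
  have hsub : Function.support (fun z => G z * (Laplacian.laplacian φ : ℂ → ℝ) z) ⊆ tsupport φ :=
    (Function.support_mul_subset_right _ _).trans (support_laplacian_subset_tsupport φ)
  refine (integrableOn_iff_integrable_of_support_subset hsub).mp ?_
  exact ContinuousOn.integrableOn_compact hK
    ((hG.mono htsupp).mul (continuous_laplacian_of_contDiff hφ).continuousOn)

/-! ### The composition (complete proof): the two stubs give the crux BY NAME -/

/-- **`InteriorHarmonicity` from the two stubs.** With `I β := ∫ G β · Δφ` (all three integrands
integrable), `stub_sum` reads `I 0 + I 1 + I 2 = 0` and `stub_diff` at `α = 0, 1, 2` reads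
`I 1 = I 2`, `I 2 = I 0`, `I 0 = I 1`; hence `I α = 0`. -/
theorem InteriorHarmonicity_of :
    Sig.stub_sum → Sig.stub_diff →
      Summit.CriticalPhenomena.CardyFormulaZ2.Theses.CardyNeumannHarmonic.InteriorHarmonicity := by
  intro hS hD T hrect u G hu hu0 hconv hcont α φ hφ hsupp htsupp hpos
  -- the two stubs on this data
  have eS := hS T hrect u G hu hu0 hconv hcont φ hφ hsupp htsupp hpos
  have eDα := fun β : Fin 3 => hD T hrect u G hu hu0 hconv hcont β φ hφ hsupp htsupp hpos
  -- abbreviate the Laplacian of the test function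
  set L : ℂ → ℝ := (Laplacian.laplacian φ : ℂ → ℝ) with hL
  -- integrability of the three integrands (no Bochner junk)
  have hint : ∀ β : Fin 3, Integrable (fun z => G β z * L z) := fun β =>
    integrable_mul_laplacian (hcont β) hφ hsupp htsupp
  -- `stub_diff`: I (β+1) - I (β+2) = 0
  have eD : ∀ β : Fin 3, (∫ z, G (β + 1) z * L z) - (∫ z, G (β + 2) z * L z) = 0 := by
    intro β
    have h := eDα β
    rw [← integral_sub (hint _) (hint _)]
    simpa only [sub_mul] using h
  -- `stub_sum`: I 0 + I 1 + I 2 = 0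
  have eS' : (∫ z, G 0 z * L z) + (∫ z, G 1 z * L z) + (∫ z, G 2 z * L z) = 0 := by
    have h01 : Integrable (fun z => G 0 z * L z + G 1 z * L z) := (hint 0).add (hint 1)
    rw [← integral_add (hint 0) (hint 1), ← integral_add h01 (hint 2)]
    simpa only [add_mul] using eS
  have e0 := eD 0
  have e1 := eD 1
  have e2 := eD 2
  simp only [Fin.isValue, show ((0 : Fin 3) + 1) = 1 from rfl, show ((0 : Fin 3) + 2) = 2 from rfl,
    show ((1 : Fin 3) + 1) = 2 from rfl, show ((1 : Fin 3) + 2) = 0 from rfl,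
    show ((2 : Fin 3) + 1) = 0 from rfl, show ((2 : Fin 3) + 2) = 1 from rfl] at e0 e1 e2
  have key0 : (∫ z, G 0 z * L z) = 0 := by linarith
  have key1 : (∫ z, G 1 z * L z) = 0 := by linarith
  have key2 : (∫ z, G 2 z * L z) = 0 := by linarith
  have hα : α = 0 ∨ α = 1 ∨ α = 2 := by fin_cases α <;> simp
  rcases hα with rfl | rfl | rfl
  · exact key0
  · exact key1
  · exact key2

end Summit.CriticalPhenomena.CardyFormulaZ2.Cruxes.InteriorHarmonicity.Birth
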